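import Summits.QuantumFields.YangMills.Theorems.ColdStartUniversalityLatticeLangevinBakryEmeryLogSobolev
import Summits.QuantumFields.YangMills.Theorems.ColdStartUniversalityUniformColdStartMixingFixedCutoffLogSobolev
import HarnessLib

/-!
# Route `ColdStartUniversality`, aside K_A1 `UniformColdStartMixing` (24809), LINE 4 «cold_entropy» — the FIXED-CUT-OFF RUNG OF (ULS)
# IN THE STRONG-COUPLING WINDOW: for cut-offs `K` with `γ ε_K > 6` the log-Sobolev constant of `μ_K` does NOT degenerate with the volume

Helper file (seat `ym-line-csu-p1`, g26; `--supports stmt-QuantumFields-24809`).  Planner-facing reading of g26's volume-uniform log-Sobolev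
inequality `wilson_generatorLogSobolev_uniform` in the (ULS) typing of g21/g22 (`c·ε_K·Ent_(μ_K)(F²) ≤ −∫ F 𝓛_K f dμ_K`, `β'_K = (γε_K)⁻¹/2`):
* ★ `uniformLogSobolev_fixedCutoff_window` — at every cut-off `K` with `6 < γ ε_K` (equivalently `|β'_K| < 1/12`), for every `C³` `f`:
  `c_K·ε_K·Ent_(μ_K)(F²) ≤ −∫ F 𝓛_K f dμ_K` with `c_K = (1 − 6/(γε_K))/(2ε_K)` — a constant INDEPENDENT of the lattice size `L_K = (F.P K).sitesPerDir 0`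
  (contrast g22's `uniformLogSobolev_fixedCutoff_explicit`: `(1/2)e^(−4|β'_K|#𝒫_K)/ε_K`, all `K`, super-exponentially small in the volume).
PLANNER-FACING, HONEST: the window `γ ε_K > 6` contains only the COARSE cut-offs (`ε_K → 0` as `K → ∞`), so this rung says nothing about the
K-UNIFORM constant (ULS) asks for; it records exactly where the Bakry–Émery mechanism stops (`|β'_K| = 1/12`).  RECORD-rung R3 plumbing; 24809 is
ASIDE and NOT restated; nothing K-uniform is proved; no crux, rung of the ladder or summit statement is proved; the Yang–Mills mass gap is NOT proved.
-/

set_option autoImplicit false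

noncomputable section

namespace Summit.QuantumFields.YangMills.Theorems.ColdStartUniversality

open MeasureTheory ProbabilityTheory
open scoped NNReal ENNReal BigOperators
open Literature.Probability.Process Literature.MathematicalPhysics.QuantumFieldTheory
open Literature.MathematicalPhysics.QuantumLattice (fundamentalRep fundamentalLatticeRep continuous_fundamentalRep)
open Literature.MathematicalPhysics.QuantumFieldTheory.Balaban1983to89

/-- ★ **The fixed-cut-off rung of (ULS) in the strong-coupling window, with an `L_K`-independent constant.**  At a cut-off `K` with
`6 < γ·ε_K` (so `β'_K = (γε_K)⁻¹/2 < 1/12`), for every `C³` function `f` of the link coordinates (`F = f∘coords`):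
`c_K·ε_K·(∫ F² log F² dμ_K − (∫ F² dμ_K) log(∫ F² dμ_K)) ≤ −∫ F 𝓛_K f dμ_K` with `c_K = (1 − 6/(γε_K))/(2ε_K)`
(`wilson_generatorLogSobolev_uniform`; `12|β'_K| = 6/(γε_K)`). [cite: ShenZhuZhu2022, §4 Theorem 4.2 and Corollary 4.4 (4.11)] -/
theorem uniformLogSobolev_fixedCutoff_window (F : T3ContinuumYM3Torus.T3Family) (γ : ℝ) (K : ℕ) (hK : 6 < γ * (F.P K).eps)
    (f : (Edge 3 ((F.P K).sitesPerDir 0) × Fin 2 × Fin 2 × Bool → ℝ) → ℝ) (hf : ContDiff ℝ 3 f) :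
    let coords : GaugeConfig 3 ((F.P K).sitesPerDir 0) (Matrix.specialUnitaryGroup (Fin 2) ℂ) →
        (Edge 3 ((F.P K).sitesPerDir 0) × Fin 2 × Fin 2 × Bool → ℝ) :=
      fun V q => (fun z : ℂ => if q.2.2.2 then z.im else z.re)
        ((fundamentalRep (Fin 2) (V q.1) : Matrix (Fin 2) (Fin 2) ℂ) q.2.1 q.2.2.1)
    let gen : GaugeConfig 3 ((F.P K).sitesPerDir 0) (Matrix.specialUnitaryGroup (Fin 2) ℂ) → ℝ := fun V =>
      (∑ i : Edge 3 ((F.P K).sitesPerDir 0) × Fin 2 × Fin 2 × Bool, fderiv ℝ f (coords V) (Pi.single i 1) *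
          (fun z : ℂ => if i.2.2.2 then z.im else z.re)
            ((latticeLangevinDynamics (fundamentalLatticeRep 2) ((γ * (F.P K).eps)⁻¹ / 2)).drift
              (matrixConfig (fundamentalRep (Fin 2)) V) i.1 i.2.1 i.2.2.1) +
      1 / 2 * ∑ i : Edge 3 ((F.P K).sitesPerDir 0) × Fin 2 × Fin 2 × Bool,
        ∑ j : Edge 3 ((F.P K).sitesPerDir 0) × Fin 2 × Fin 2 × Bool,
        fderiv ℝ (fun z => fderiv ℝ f z (Pi.single i 1)) (coords V) (Pi.single j 1) *
          ∑ n : Edge 3 ((F.P K).sitesPerDir 0) × NoiseIdx 2,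
            (if n.1 = i.1 then (fun z : ℂ => if i.2.2.2 then z.im else z.re)
              ((latticeLangevinDynamics (fundamentalLatticeRep 2) ((γ * (F.P K).eps)⁻¹ / 2)).noise
                (matrixConfig (fundamentalRep (Fin 2)) V) i.1 n.2 i.2.1 i.2.2.1) else 0) *
            (if n.1 = j.1 then (fun z : ℂ => if j.2.2.2 then z.im else z.re)
              ((latticeLangevinDynamics (fundamentalLatticeRep 2) ((γ * (F.P K).eps)⁻¹ / 2)).noise
                (matrixConfig (fundamentalRep (Fin 2)) V) j.1 n.2 j.2.1 j.2.2.1) else 0))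
    (1 - 6 / (γ * (F.P K).eps)) / (2 * (F.P K).eps) * (F.P K).eps * ((∫ V, f (coords V) ^ 2 * Real.log (f (coords V) ^ 2) ∂(wilsonMeasure (d := 3) (L := ((F.P K).sitesPerDir 0)) (fundamentalRep (Fin 2)) ((γ * (F.P K).eps)⁻¹ / 2))) - (∫ V, f (coords V) ^ 2 ∂(wilsonMeasure (d := 3) (L := ((F.P K).sitesPerDir 0)) (fundamentalRep (Fin 2)) ((γ * (F.P K).eps)⁻¹ / 2))) * Real.log (∫ V, f (coords V) ^ 2 ∂(wilsonMeasure (d := 3) (L := ((F.P K).sitesPerDir 0)) (fundamentalRep (Fin 2)) ((γ * (F.P K).eps)⁻¹ / 2)))) ≤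
      -∫ V, f (coords V) * gen V ∂(wilsonMeasure (d := 3) (L := ((F.P K).sitesPerDir 0)) (fundamentalRep (Fin 2)) ((γ * (F.P K).eps)⁻¹ / 2)) := by
  have hε : 0 < (F.P K).eps := (F.P K).eps_pos
  have hγε : 0 < γ * (F.P K).eps := lt_trans (by norm_num) hK
  have hβ : |((γ * (F.P K).eps)⁻¹ / 2)| < 1 / 12 := by
    rw [abs_of_pos (by positivity)]
    rw [div_lt_iff₀ (by norm_num : (0:ℝ) < 2), inv_lt_comm₀ hγε (by norm_num)]
    linarith
  have h := wilson_generatorLogSobolev_uniform ((F.P K).sitesPerDir 0) ((γ * (F.P K).eps)⁻¹ / 2) hβ f hf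
  have e : (1 - 6 / (γ * (F.P K).eps)) / (2 * (F.P K).eps) * (F.P K).eps = (1 - 12 * |((γ * (F.P K).eps)⁻¹ / 2)|) / 2 := by
    rw [abs_of_pos (by positivity)]
    field_simp
    ring
  rw [e]
  exact h

end Summit.QuantumFields.YangMills.Theorems.ColdStartUniversality
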